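import Literature.NumberTheory.Rogawski1990.CartanObstructionDegreeOne
import Literature.NumberTheory.Rogawski1990.FinExplicitTransferFactorKappaEigenvector
import Literature.NumberTheory.Rogawski1990.ExplicitFactorRationalLocalisation
import Literature.NumberTheory.Rogawski1990.GRegularLocalisation
import Literature.NumberTheory.Rogawski1990.KottwitzSignTwistedFrame
import Literature.NumberTheory.Automorphic.QuadraticLocalNormResidueBridge
import Literature.NumberTheory.GaloisRepresentations.QuadraticIdeleNormResidueExact
import HarnessLib

/-!
# The signs `κ_v` of Rogawski's explicit finite-place transfer factors `Δ‴_v` at an ADELIC matching pair `((γ_H)_v, p_v)` ARE the local norm-residue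
# symbols `(W_v, θ)_v` of the `H′`-value `W` of the transported eigenvector (Rogawski 1990, §14.6 p. 242, §4.3 (4.3.3) p. 44, §3.5 Prop. 3.5.2 (c) p. 29)

Topic `NumberTheory/Rogawski1990`; namespace `Literature.NumberTheory.Rogawski1990`; **THEOREMS ONLY** (no definition, no named fact, no instance, no
notation, no `sorry`).  Cell `pub/hodgecm-mathlib`, ENGINE T1 (crux H413 = `stmt-HodgeConjecture-24833`), T6 #72-side node **N5** (the (4.3.3) clause
`GlobalKappaFormula` of ★ `GlobalTransferWithCartanKappaFormula` at `Δ‴ := finExplicitCollection`, T6-L3 `stub_kappaFormula`; desk TABLE #4, F0P3a-p04 (g8)),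
part (A1) = the FINITE places: ★ `finKappaAt` (the `κ_v` of ★ `finExplicitDelta`) evaluated at the local components `((γ_H)_v, p_v)` of a rational `G`-regular
`γ_H ∈ H(L⁺)` and a matching ADÈLE `p` (not necessarily rational) equals the Hilbert symbol `(W_v, θ)_v`, `L = L⁺(√θ)`, of the idèle `W ∈ 𝕀_{L⁺}` below the
`H′`-value `⟨g(v₀⊗1), g(v₀⊗1)⟩_{H′⊗1}` of the transported eigenvector (★ `MatchingAdeleG₂.exists_ideleBaseChange_eq_hermForm`,
★ `MatchingAdeleG₂.cartanObsFun_eq_quadraticArtinIndicator_hermForm`: `[W]_{L⁺,θ} = (obs p)_𝔪`).  HC_CM is proved only modulo the printed citations until rung 0 closes.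

THE MATHEMATICS.  `p = g(γ₀ ⊗ 1)g⁻¹` adelically and `γ₀ v₀ = u v₀` (`u = (γ_H.2)₀₀`) give the ADELIC eigen-equation `p · g(v₀⊗1) = (u⊗1) · g(v₀⊗1)` (§1), which
localises at `v` to `p_v · p′ = γ₂((γ_H)_v) · p′`, `p′ = (g(v₀⊗1))_v ≠ 0` (★ `finGammaTwo_rationalComponent`); `G`-regularity makes `χ_g(γ₂)` a unit
(★ `isUnit_eval_finCharpolyTwo_of_isLocalGRegular` ∘ ★ `isLocalGRegular_rationalComponent`), so F0P3a-p01's ★ `finKappaAt_eq_ite_of_eigenvector` reads `κ_v`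
on `p′`: its `H′_v`-value is `(con W)_v = ι_v(W_v)` (★ `adeleToLocal_ideleBaseChange`) and the unit-norm test on `ι_v(W_v)` is `(W_v, θ)_v`
(F0P3a-p05's ★ `ite_normTest_eq_hilbertSymbol`); at a split `v` both sides are `+1`.  Print [§14.6 p. 242]: «`κ(γ, ψ_v(i(γ)))` is equal to `±1` and it is `+1`
for almost all `v`» — §2 proves both halves for `Δ‴`.

* §1 `MatchingAdele.adele_mulVec_conj_mulVec_eq_smul` (adelic eigen-equation), `MatchingAdele.toLocal_mulVec_eigenvector` (localised),
  `adeleToLocal_comp_mulVec_ne_zero`, `sum_sum_conjLocal_adelicForm_eq_toLocalRing` (`Σσ(p′ᵢ)(H′⊗1)_{v,ik}p′ₖ = ι_v(W_v)`).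
* §2 **`MatchingAdele.finKappaAt_toLocal_eq_hilbertSymbol`** (`κ_v((γ_H)_v, p_v) = (W_v, θ)_v`, every finite `v`), **`MatchingAdele.eventually_finKappaAt_toLocal_eq_one`**
  (`κ_v = 1` for almost all `v`, ★ `finite_setOf_ideleFiniteComponent_not_mem_quadraticNormSubgroup`), `MatchingAdele.prod_finKappaAt_toLocal_eq_prod_hilbertSymbol`.
Sequel (A2) = the archimedean `κ‴_w`; (B) = `∏_v κ_v ∏_w κ‴_w = (−1)^{[W]} = (e 𝒪H)(obs p)` and the (4.3.3) clause.

## References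
* [Rogawski1990] J. D. Rogawski, *Automorphic Representations of Unitary Groups in Three Variables*, Ann. of Math. Stud. 123 (1990), §3.3 (3.3.1) p. 22; §3.5
  Prop. 3.5.2 (c) p. 29; §4.3 (4.3.3) p. 44; §4.9 p. 55; §14.6 p. 242.
* [LanglandsShelstad1987] R. P. Langlands, D. Shelstad, *On the definition of transfer factors*, Math. Ann. 278 (1987), §2 (the `κ`-weights `⟨inv, s⟩`).
* [Omeara1963] O. T. O'Meara, *Introduction to Quadratic Forms* (1963), §63B, §65A (local norms and the Hilbert symbol; Example 65:4).
* [CasselsFrohlichANT1967] Cassels–Fröhlich (eds.), *Algebraic Number Theory* (1967), Ch. II §10–§11; Ch. VII §7.3 (a).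
-/

set_option autoImplicit false

noncomputable section

open NumberField IsDedekindDomain Matrix Polynomial
open Literature.NumberTheory.GaloisRepresentations Literature.NumberTheory.QuadraticForms
open scoped MatrixGroups

namespace Literature.NumberTheory.Rogawski1990

open Literature.NumberTheory.Automorphic Literature.LinearAlgebra.Matrix
open Literature.AlgebraicGeometry.ShimuraVarieties (unitaryGroup hermForm)

section Fin

variable {L : Type} [Field L] [NumberField L] [IsCMField L] {H' : Matrix (Fin 3) (Fin 3) L}
  {γH : (UnitaryGroup.cmDatum L 2 (Matrix.of fun i j : Fin 2 => if i.val + j.val + 1 = 2 then (1 : L) else 0)).Rational ×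
    (UnitaryGroup.cmDatum L 1 (Matrix.of fun i j : Fin 1 => if i.val + j.val + 1 = 1 then (1 : L) else 0)).Rational}
  {γ₀ : (UnitaryGroup.cmDatum L 3 H').Rational}

/-- `(A.map f) (f ∘ v) = f ∘ (A v)` (Mathlib `RingHom.map_mulVec`, function form). [folklore] -/
private theorem map_mulVec_comp' {R S : Type*} [CommRing R] [CommRing S] {m : ℕ} (f : R →+* S) (A : Matrix (Fin m) (Fin m) R) (v : Fin m → R) :
    A.map f *ᵥ (f ∘ v) = f ∘ (A *ᵥ v) := by
  funext i
  exact (RingHom.map_mulVec f A v i).symm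

/-- **The adelic eigen-equation**: for an adelic conjugator `g` of `p` over `γ₀` (`g (γ₀ ⊗ 1) g⁻¹ = p`) and `γ₀ v₀ = u v₀`, the adelic vector `g (v₀ ⊗ 1)` is a
`u ⊗ 1`-eigenvector of `p`: `p · g(v₀ ⊗ 1) = (u ⊗ 1) · g(v₀ ⊗ 1)`. [cite: Rogawski1990, §3.3 (3.3.1) p. 22] -/
theorem MatchingAdele.adele_mulVec_conj_mulVec_eq_smul (p : MatchingAdele L H' γH) {g : GL (Fin 3) (AdeleRing (𝓞 L) L)}
    (hg : g * (((UnitaryGroup.cmDatum L 3 H').toAdelic γ₀).val : GL (Fin 3) (AdeleRing (𝓞 L) L)) * g⁻¹ = (p.adele.val : GL (Fin 3) (AdeleRing (𝓞 L) L)))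
    {u : L} {v₀ : Fin 3 → L} (hv₀ : (((γ₀ : unitaryGroup (cmConjRingHom L) H').val : GL (Fin 3) L) : Matrix (Fin 3) (Fin 3) L) *ᵥ v₀ = u • v₀) :
    ((p.adele.val : GL (Fin 3) (AdeleRing (𝓞 L) L)) : Matrix (Fin 3) (Fin 3) (AdeleRing (𝓞 L) L)) *ᵥ
        ((g : Matrix (Fin 3) (Fin 3) (AdeleRing (𝓞 L) L)) *ᵥ ((algebraMap L (AdeleRing (𝓞 L) L)) ∘ v₀)) =
      algebraMap L (AdeleRing (𝓞 L) L) u • ((g : Matrix (Fin 3) (Fin 3) (AdeleRing (𝓞 L) L)) *ᵥ ((algebraMap L (AdeleRing (𝓞 L) L)) ∘ v₀)) := by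
  have hγA : ((((UnitaryGroup.cmDatum L 3 H').toAdelic γ₀).val : GL (Fin 3) (AdeleRing (𝓞 L) L)) : Matrix (Fin 3) (Fin 3) (AdeleRing (𝓞 L) L)) =
      (((γ₀ : unitaryGroup (cmConjRingHom L) H').val : GL (Fin 3) L) : Matrix (Fin 3) (Fin 3) L).map (algebraMap L (AdeleRing (𝓞 L) L)) := rfl
  have hPg : ((p.adele.val : GL (Fin 3) (AdeleRing (𝓞 L) L)) : Matrix (Fin 3) (Fin 3) (AdeleRing (𝓞 L) L)) * (g : Matrix (Fin 3) (Fin 3) (AdeleRing (𝓞 L) L)) =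
      (g : Matrix (Fin 3) (Fin 3) (AdeleRing (𝓞 L) L)) * (((UnitaryGroup.cmDatum L 3 H').toAdelic γ₀).val : GL (Fin 3) (AdeleRing (𝓞 L) L)) := by
    have h := congrArg (fun x : GL (Fin 3) (AdeleRing (𝓞 L) L) => ((x * g : GL (Fin 3) (AdeleRing (𝓞 L) L)) : Matrix (Fin 3) (Fin 3) (AdeleRing (𝓞 L) L))) hg
    simp only [inv_mul_cancel_right, Units.val_mul] at h
    exact h.symm
  rw [Matrix.mulVec_mulVec, hPg, ← Matrix.mulVec_mulVec, hγA, map_mulVec_comp', hv₀]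
  have h : (algebraMap L (AdeleRing (𝓞 L) L)) ∘ (u • v₀) = algebraMap L (AdeleRing (𝓞 L) L) u • ((algebraMap L (AdeleRing (𝓞 L) L)) ∘ v₀) := by
    funext i
    simp only [Function.comp_apply, Pi.smul_apply, smul_eq_mul, map_mul]
  rw [h, Matrix.mulVec_smul]

/-- **… localised at a finite place `v`**: `p_v · (g(v₀⊗1))_v = γ₂((γ_H)_v) · (g(v₀⊗1))_v` when `u = (γ_H.2)₀₀` (★ `finGammaTwo_rationalComponent`).
[cite: Rogawski1990, §3.3 (3.3.1) p. 22; §4.9 p. 55] -/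
theorem MatchingAdele.toLocal_mulVec_eigenvector (p : MatchingAdele L H' γH) {g : GL (Fin 3) (AdeleRing (𝓞 L) L)}
    (hg : g * (((UnitaryGroup.cmDatum L 3 H').toAdelic γ₀).val : GL (Fin 3) (AdeleRing (𝓞 L) L)) * g⁻¹ = (p.adele.val : GL (Fin 3) (AdeleRing (𝓞 L) L)))
    {v₀ : Fin 3 → L}
    (hv₀ : (((γ₀ : unitaryGroup (cmConjRingHom L) H').val : GL (Fin 3) L) : Matrix (Fin 3) (Fin 3) L) *ᵥ v₀ = ((γH.2.val.val : Matrix (Fin 1) (Fin 1) L) 0 0) • v₀)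
    (v : HeightOneSpectrum (𝓞 ↥(maximalRealSubfield L))) :
    ((((UnitaryGroup.cmDatum L 3 H').toLocal v p.adele).val.val : Matrix (Fin 3) (Fin 3) (UnitaryGroup.LocalRing L v))) *ᵥ
        ((UnitaryGroup.adeleToLocal L v) ∘ ((g : Matrix (Fin 3) (Fin 3) (AdeleRing (𝓞 L) L)) *ᵥ ((algebraMap L (AdeleRing (𝓞 L) L)) ∘ v₀))) =
      finGammaTwo L v (rationalComponent L γH v) •
        ((UnitaryGroup.adeleToLocal L v) ∘ ((g : Matrix (Fin 3) (Fin 3) (AdeleRing (𝓞 L) L)) *ᵥ ((algebraMap L (AdeleRing (𝓞 L) L)) ∘ v₀))) := by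
  have e : ((((UnitaryGroup.cmDatum L 3 H').toLocal v p.adele).val.val : Matrix (Fin 3) (Fin 3) (UnitaryGroup.LocalRing L v))) =
      (((p.adele.val : GL (Fin 3) (AdeleRing (𝓞 L) L)) : Matrix (Fin 3) (Fin 3) (AdeleRing (𝓞 L) L))).map (UnitaryGroup.adeleToLocal L v) := rfl
  rw [e, map_mulVec_comp', p.adele_mulVec_conj_mulVec_eq_smul hg hv₀, finGammaTwo_rationalComponent]
  funext i
  simp only [Function.comp_apply, Pi.smul_apply, smul_eq_mul, map_mul]
  rfl

omit [IsCMField L] in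
/-- **The transported eigenvector is non-zero at every finite place**: `(g(v₀ ⊗ 1))_v ≠ 0` (`g_v` invertible, `L ↪ L ⊗_{L⁺} L⁺_v = ∏_{w∣v} L_w` injective).
[cite: CasselsFrohlichANT1967, Ch. II §10–§11] -/
theorem adeleToLocal_comp_mulVec_ne_zero (g : GL (Fin 3) (AdeleRing (𝓞 L) L)) {v₀ : Fin 3 → L} (hv₀0 : v₀ ≠ 0)
    (v : HeightOneSpectrum (𝓞 ↥(maximalRealSubfield L))) :
    (UnitaryGroup.adeleToLocal L v) ∘ ((g : Matrix (Fin 3) (Fin 3) (AdeleRing (𝓞 L) L)) *ᵥ ((algebraMap L (AdeleRing (𝓞 L) L)) ∘ v₀)) ≠ 0 := by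
  intro h0
  apply hv₀0
  have h1 : (UnitaryGroup.adeleToLocal L v) ∘ (((g⁻¹ : GL (Fin 3) (AdeleRing (𝓞 L) L)) : Matrix (Fin 3) (Fin 3) (AdeleRing (𝓞 L) L)) *ᵥ
      ((g : Matrix (Fin 3) (Fin 3) (AdeleRing (𝓞 L) L)) *ᵥ ((algebraMap L (AdeleRing (𝓞 L) L)) ∘ v₀))) = 0 := by
    rw [← map_mulVec_comp', h0, Matrix.mulVec_zero]
  rw [Matrix.mulVec_mulVec, ← Units.val_mul, inv_mul_cancel, Units.val_one, Matrix.one_mulVec] at h1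
  funext i
  have hi := congrFun h1 i
  rw [Function.comp_apply, Function.comp_apply, UnitaryGroup.adeleToLocal_algebraMap, Pi.zero_apply] at hi
  exact algebraMap_localRing_injective L v (hi.trans (map_zero _).symm)

omit [IsCMField L] in
/-- A ring map intertwining two involutions carries `⟨x, x⟩_H` to the double sum `Σ_{i,k} σ′(f x_i) (fH)_{ik} (f x_k)`. [folklore] -/
private theorem map_hermForm_eq_sum_sum {R S : Type*} [CommRing R] [CommRing S] (f : R →+* S) (σ : R →+* R) (σ' : S →+* S)
    (hf : ∀ r, f (σ r) = σ' (f r)) {m : ℕ} (M : Matrix (Fin m) (Fin m) R) (x : Fin m → R) :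
    f (hermForm σ M x x) = ∑ i, ∑ k, σ' (f (x i)) * (M.map f) i k * f (x k) := by
  unfold hermForm
  simp only [dotProduct, Matrix.mulVec, Function.comp_apply, map_sum, map_mul, Matrix.map_apply, hf, Finset.mul_sum, mul_assoc]

/-- **The local `H′`-value of the transported eigenvector is `W_v ⊗ 1`**: `Σ_{i,k} (c⊗1)(p′_i) (H′⊗1)_{v,ik} p′_k = ι_v(W_v)` for `p′ = (g(v₀⊗1))_v` and
`con W = ⟨g(v₀⊗1), g(v₀⊗1)⟩_{H′⊗1}` (★ `adeleToLocal_ideleBaseChange`). [cite: CasselsFrohlichANT1967, Ch. II §10–§11; Ch. VII §7.3 (a)] -/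
theorem sum_sum_conjLocal_adelicForm_eq_toLocalRing (g : GL (Fin 3) (AdeleRing (𝓞 L) L)) (v₀ : Fin 3 → L)
    (W : (AdeleRing (𝓞 ↥(maximalRealSubfield L)) ↥(maximalRealSubfield L))ˣ)
    (hW : ((AdeleRing.ideleBaseChange (↥(maximalRealSubfield L)) L W : (AdeleRing (𝓞 L) L)ˣ) : AdeleRing (𝓞 L) L) =
      hermForm (adeleConj L) (H'.map (algebraMap L (AdeleRing (𝓞 L) L)))
        ((g : Matrix (Fin 3) (Fin 3) (AdeleRing (𝓞 L) L)) *ᵥ ((algebraMap L (AdeleRing (𝓞 L) L)) ∘ v₀))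
        ((g : Matrix (Fin 3) (Fin 3) (AdeleRing (𝓞 L) L)) *ᵥ ((algebraMap L (AdeleRing (𝓞 L) L)) ∘ v₀)))
    (v : HeightOneSpectrum (𝓞 ↥(maximalRealSubfield L))) :
    (∑ i : Fin 3, ∑ k : Fin 3,
        UnitaryGroup.conjLocal L (IsCMField.complexConj L) v
            (((UnitaryGroup.adeleToLocal L v) ∘ ((g : Matrix (Fin 3) (Fin 3) (AdeleRing (𝓞 L) L)) *ᵥ ((algebraMap L (AdeleRing (𝓞 L) L)) ∘ v₀))) i) *
          ((UnitaryGroup.adelicForm L 3 H').map (UnitaryGroup.adeleToLocal L v)) i k *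
          ((UnitaryGroup.adeleToLocal L v) ∘ ((g : Matrix (Fin 3) (Fin 3) (AdeleRing (𝓞 L) L)) *ᵥ ((algebraMap L (AdeleRing (𝓞 L) L)) ∘ v₀))) k) =
      UnitaryGroup.toLocalRing L v (((W : (AdeleRing (𝓞 ↥(maximalRealSubfield L)) ↥(maximalRealSubfield L))ˣ) :
        AdeleRing (𝓞 ↥(maximalRealSubfield L)) ↥(maximalRealSubfield L)).2 v) := by
  rw [← adeleToLocal_ideleBaseChange, hW, map_hermForm_eq_sum_sum (UnitaryGroup.adeleToLocal L v) (adeleConj L)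
    (UnitaryGroup.conjLocal L (IsCMField.complexConj L) v) (fun r => UnitaryGroup.adeleToLocal_conj L (IsCMField.complexConj L) v r)]
  rfl

end Fin

/-! ## §2 `κ_v` of the explicit factor `Δ‴_v` at `((γ_H)_v, p_v)` IS the Hilbert symbol `(W_v, θ)_v` -/

section Kappa

variable {L : Type} [Field L] [NumberField L] [IsCMField L] {H' : Matrix (Fin 3) (Fin 3) L}
  {γH : (UnitaryGroup.cmDatum L 2 (Matrix.of fun i j : Fin 2 => if i.val + j.val + 1 = 2 then (1 : L) else 0)).Rational ×
    (UnitaryGroup.cmDatum L 1 (Matrix.of fun i j : Fin 1 => if i.val + j.val + 1 = 1 then (1 : L) else 0)).Rational}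
  {γ₀ : (UnitaryGroup.cmDatum L 3 H').Rational}

/-- **`κ_v((γ_H)_v, p_v) = (W_v, θ)_v` AT EVERY FINITE PLACE.**  For `γ_H ∈ H(L⁺)` `G`-regular, a matching adèle `p` over `γ_H` whose adèle is `g (γ₀ ⊗ 1) g⁻¹`
(`γ₀ ∈ U(H′)(L⁺)` rational with `γ₀ v₀ = u v₀`, `v₀ ≠ 0`, `u = (γ_H.2)₀₀` the `U(Φ₁)`-coordinate), and the idèle `W ∈ 𝕀_{L⁺}` below `⟨g(v₀⊗1), g(v₀⊗1)⟩_{H′⊗1}`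
(★ `MatchingAdeleG₂.exists_ideleBaseChange_eq_hermForm`): the sign `κ_v` of Rogawski's explicit factor (★ `finKappaAt`) is the local norm-residue symbol of `L∕L⁺`
at `W_v` — non-split `v`: ★ `finKappaAt_eq_ite_of_eigenvector` on the eigenvector `(g(v₀⊗1))_v` + ★ `exists_isUnit_toLocalRing_eq_mul_conjLocal_iff`; split `v`: both
sides are `+1` (★ `finKappaAt_eq_one_of_eigenvector_of_not_subsingleton`, ★ `hilbertSymbol_eq_one_of_not_subsingleton`).  Print: `κ(γ, ψ_v(i(γ))) = ±1` is the
value of the endoscopic character on `inv_v`. [cite: Rogawski1990, §14.6 p. 242; §4.3 (4.3.3) p. 44; §3.5 Prop. 3.5.2 (c) p. 29] [cite: LanglandsShelstad1987, §2]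
[cite: Omeara1963, §63B with §65A] -/
theorem MatchingAdele.finKappaAt_toLocal_eq_hilbertSymbol (p : MatchingAdele L H' γH)
    (hGreg : IsGRegular (cmConjRingHom L) (Matrix.of fun i j : Fin 2 => if i.val + j.val + 1 = 2 then (1 : L) else 0)
        (Matrix.of fun i j : Fin 1 => if i.val + j.val + 1 = 1 then (1 : L) else 0)
        (Matrix.of fun i j : Fin 3 => if i.val + j.val + 1 = 3 then (1 : L) else 0) endoForm_antidiagOne γH)
    {g : GL (Fin 3) (AdeleRing (𝓞 L) L)}
    (hg : g * (((UnitaryGroup.cmDatum L 3 H').toAdelic γ₀).val : GL (Fin 3) (AdeleRing (𝓞 L) L)) * g⁻¹ = (p.adele.val : GL (Fin 3) (AdeleRing (𝓞 L) L)))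
    {v₀ : Fin 3 → L}
    (hv₀ : (((γ₀ : unitaryGroup (cmConjRingHom L) H').val : GL (Fin 3) L) : Matrix (Fin 3) (Fin 3) L) *ᵥ v₀ = ((γH.2.val.val : Matrix (Fin 1) (Fin 1) L) 0 0) • v₀)
    (hv₀0 : v₀ ≠ 0) (W : (AdeleRing (𝓞 ↥(maximalRealSubfield L)) ↥(maximalRealSubfield L))ˣ)
    (hW : ((AdeleRing.ideleBaseChange (↥(maximalRealSubfield L)) L W : (AdeleRing (𝓞 L) L)ˣ) : AdeleRing (𝓞 L) L) =
      hermForm (adeleConj L) (H'.map (algebraMap L (AdeleRing (𝓞 L) L)))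
        ((g : Matrix (Fin 3) (Fin 3) (AdeleRing (𝓞 L) L)) *ᵥ ((algebraMap L (AdeleRing (𝓞 L) L)) ∘ v₀))
        ((g : Matrix (Fin 3) (Fin 3) (AdeleRing (𝓞 L) L)) *ᵥ ((algebraMap L (AdeleRing (𝓞 L) L)) ∘ v₀)))
    (v : HeightOneSpectrum (𝓞 ↥(maximalRealSubfield L))) :
    finKappaAt L v H' (rationalComponent L γH v) ((UnitaryGroup.cmDatum L 3 H').toLocal v p.adele) =
      hilbertSymbol (v.adicCompletion ↥(maximalRealSubfield L))
        ((((W : (AdeleRing (𝓞 ↥(maximalRealSubfield L)) ↥(maximalRealSubfield L))ˣ) : AdeleRing (𝓞 ↥(maximalRealSubfield L)) ↥(maximalRealSubfield L)).2 v :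
          v.adicCompletion ↥(maximalRealSubfield L)))
        ((cmQuadraticGenerator L : ↥(maximalRealSubfield L)) : v.adicCompletion ↥(maximalRealSubfield L)) := by
  classical
  obtain ⟨α, hα0, hcα, hsq⟩ := cmQuadraticGenerator_spec L
  have hd : α * α = algebraMap (↥(maximalRealSubfield L)) L (cmQuadraticGenerator L : ↥(maximalRealSubfield L)) := by rw [← sq]; exact hsq
  set p' : Fin 3 → UnitaryGroup.LocalRing L v :=
    (UnitaryGroup.adeleToLocal L v) ∘ ((g : Matrix (Fin 3) (Fin 3) (AdeleRing (𝓞 L) L)) *ᵥ ((algebraMap L (AdeleRing (𝓞 L) L)) ∘ v₀)) with hp'def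
  have hp' := p.toLocal_mulVec_eigenvector hg hv₀ v
  have hne : p' ≠ 0 := adeleToLocal_comp_mulVec_ne_zero g hv₀0 v
  have hu : IsUnit ((finCharpolyTwo L v (rationalComponent L γH v)).eval (finGammaTwo L v (rationalComponent L γH v))) :=
    isUnit_eval_finCharpolyTwo_of_isLocalGRegular L v (rationalComponent L γH v) (isLocalGRegular_rationalComponent L γH hGreg v)
  have hx : ((((W : (AdeleRing (𝓞 ↥(maximalRealSubfield L)) ↥(maximalRealSubfield L))ˣ) : AdeleRing (𝓞 ↥(maximalRealSubfield L)) ↥(maximalRealSubfield L)).2 v :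
      v.adicCompletion ↥(maximalRealSubfield L))) ≠ 0 := (ideleFiniteComponent (↥(maximalRealSubfield L)) v W).ne_zero
  by_cases hvs : Subsingleton (UnitaryGroup.PlacesOver L v)
  · rw [finKappaAt_eq_ite_of_eigenvector L v H' _ _ hvs (p.isLocalNormPair v) hu hp' hne, sum_sum_conjLocal_adelicForm_eq_toLocalRing g v₀ W hW v,
      ← UnitaryGroup.ite_normTest_eq_hilbertSymbol L (IsCMField.complexConj L) hcα hα0 hd (IsCMField.complexConj_ne_one L) v hx, if_neg (not_not.2 hvs)]
  · rw [finKappaAt_eq_one_of_eigenvector_of_not_subsingleton L v H' _ _ hvs hu hp' hne,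
      UnitaryGroup.hilbertSymbol_eq_one_of_not_subsingleton L (IsCMField.complexConj L) hcα hα0 hd (IsCMField.complexConj_ne_one L) v hvs hx]

/-- **`κ_v = 1` for almost all `v`** on the same data: `W_v` is a local norm at all but finitely many places (★ `finite_setOf_ideleFiniteComponent_not_mem_quadraticNormSubgroup`).
Print: «`κ(γ, ψ_v(i(γ)))` … is `+1` for almost all `v`». [cite: Rogawski1990, §14.6 p. 242] [cite: Omeara1963, §65A Example 65:4] -/
theorem MatchingAdele.eventually_finKappaAt_toLocal_eq_one (p : MatchingAdele L H' γH)
    (hGreg : IsGRegular (cmConjRingHom L) (Matrix.of fun i j : Fin 2 => if i.val + j.val + 1 = 2 then (1 : L) else 0)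
        (Matrix.of fun i j : Fin 1 => if i.val + j.val + 1 = 1 then (1 : L) else 0)
        (Matrix.of fun i j : Fin 3 => if i.val + j.val + 1 = 3 then (1 : L) else 0) endoForm_antidiagOne γH)
    {g : GL (Fin 3) (AdeleRing (𝓞 L) L)}
    (hg : g * (((UnitaryGroup.cmDatum L 3 H').toAdelic γ₀).val : GL (Fin 3) (AdeleRing (𝓞 L) L)) * g⁻¹ = (p.adele.val : GL (Fin 3) (AdeleRing (𝓞 L) L)))
    {v₀ : Fin 3 → L}
    (hv₀ : (((γ₀ : unitaryGroup (cmConjRingHom L) H').val : GL (Fin 3) L) : Matrix (Fin 3) (Fin 3) L) *ᵥ v₀ = ((γH.2.val.val : Matrix (Fin 1) (Fin 1) L) 0 0) • v₀)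
    (hv₀0 : v₀ ≠ 0) (W : (AdeleRing (𝓞 ↥(maximalRealSubfield L)) ↥(maximalRealSubfield L))ˣ)
    (hW : ((AdeleRing.ideleBaseChange (↥(maximalRealSubfield L)) L W : (AdeleRing (𝓞 L) L)ˣ) : AdeleRing (𝓞 L) L) =
      hermForm (adeleConj L) (H'.map (algebraMap L (AdeleRing (𝓞 L) L)))
        ((g : Matrix (Fin 3) (Fin 3) (AdeleRing (𝓞 L) L)) *ᵥ ((algebraMap L (AdeleRing (𝓞 L) L)) ∘ v₀))
        ((g : Matrix (Fin 3) (Fin 3) (AdeleRing (𝓞 L) L)) *ᵥ ((algebraMap L (AdeleRing (𝓞 L) L)) ∘ v₀))) :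
    ∀ᶠ v : HeightOneSpectrum (𝓞 ↥(maximalRealSubfield L)) in Filter.cofinite,
      finKappaAt L v H' (rationalComponent L γH v) ((UnitaryGroup.cmDatum L 3 H').toLocal v p.adele) = 1 := by
  have hθ0 : (cmQuadraticGenerator L : ↥(maximalRealSubfield L)) ≠ 0 := by
    obtain ⟨α, hα0, -, hsq⟩ := cmQuadraticGenerator_spec L
    intro h
    rw [h, map_zero, sq_eq_zero_iff] at hsq
    exact hα0 hsq
  have hfin := finite_setOf_ideleFiniteComponent_not_mem_quadraticNormSubgroup hθ0 W
  refine Filter.eventually_cofinite.2 (hfin.subset fun v hv => ?_)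
  rw [Set.mem_setOf_eq, p.finKappaAt_toLocal_eq_hilbertSymbol hGreg hg hv₀ hv₀0 W hW v] at hv
  rw [Set.mem_setOf_eq]
  intro hmem
  apply hv
  haveI : CharZero (v.adicCompletion ↥(maximalRealSubfield L)) :=
    charZero_of_injective_algebraMap (algebraMap (↥(maximalRealSubfield L)) (v.adicCompletion ↥(maximalRealSubfield L))).injective
  haveI : NeZero (2 : v.adicCompletion ↥(maximalRealSubfield L)) := ⟨two_ne_zero⟩
  have hθ0' : ((cmQuadraticGenerator L : ↥(maximalRealSubfield L)) : v.adicCompletion ↥(maximalRealSubfield L)) ≠ 0 := by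
    rw [ne_eq, ← map_zero (algebraMap (↥(maximalRealSubfield L)) (v.adicCompletion ↥(maximalRealSubfield L)))]
    exact fun h => hθ0 ((algebraMap (↥(maximalRealSubfield L)) (v.adicCompletion ↥(maximalRealSubfield L))).injective h)
  rw [← val_ideleFiniteComponent]
  exact (hilbertSymbol_eq_one_iff_mem_quadraticNormSubgroup hθ0' _).2 hmem

/-- The finite products of `κ_v`'s over any finite set of places are the corresponding products of Hilbert symbols (bookkeeping for (4.3.3)).
[cite: Rogawski1990, §4.3 (4.3.3) p. 44; §14.6 p. 242] -/
theorem MatchingAdele.prod_finKappaAt_toLocal_eq_prod_hilbertSymbol (p : MatchingAdele L H' γH)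
    (hGreg : IsGRegular (cmConjRingHom L) (Matrix.of fun i j : Fin 2 => if i.val + j.val + 1 = 2 then (1 : L) else 0)
        (Matrix.of fun i j : Fin 1 => if i.val + j.val + 1 = 1 then (1 : L) else 0)
        (Matrix.of fun i j : Fin 3 => if i.val + j.val + 1 = 3 then (1 : L) else 0) endoForm_antidiagOne γH)
    {g : GL (Fin 3) (AdeleRing (𝓞 L) L)}
    (hg : g * (((UnitaryGroup.cmDatum L 3 H').toAdelic γ₀).val : GL (Fin 3) (AdeleRing (𝓞 L) L)) * g⁻¹ = (p.adele.val : GL (Fin 3) (AdeleRing (𝓞 L) L)))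
    {v₀ : Fin 3 → L}
    (hv₀ : (((γ₀ : unitaryGroup (cmConjRingHom L) H').val : GL (Fin 3) L) : Matrix (Fin 3) (Fin 3) L) *ᵥ v₀ = ((γH.2.val.val : Matrix (Fin 1) (Fin 1) L) 0 0) • v₀)
    (hv₀0 : v₀ ≠ 0) (W : (AdeleRing (𝓞 ↥(maximalRealSubfield L)) ↥(maximalRealSubfield L))ˣ)
    (hW : ((AdeleRing.ideleBaseChange (↥(maximalRealSubfield L)) L W : (AdeleRing (𝓞 L) L)ˣ) : AdeleRing (𝓞 L) L) =
      hermForm (adeleConj L) (H'.map (algebraMap L (AdeleRing (𝓞 L) L)))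
        ((g : Matrix (Fin 3) (Fin 3) (AdeleRing (𝓞 L) L)) *ᵥ ((algebraMap L (AdeleRing (𝓞 L) L)) ∘ v₀))
        ((g : Matrix (Fin 3) (Fin 3) (AdeleRing (𝓞 L) L)) *ᵥ ((algebraMap L (AdeleRing (𝓞 L) L)) ∘ v₀)))
    (S : Finset (HeightOneSpectrum (𝓞 ↥(maximalRealSubfield L)))) :
    ∏ v ∈ S, finKappaAt L v H' (rationalComponent L γH v) ((UnitaryGroup.cmDatum L 3 H').toLocal v p.adele) =
      ∏ v ∈ S, hilbertSymbol (v.adicCompletion ↥(maximalRealSubfield L))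
        ((((W : (AdeleRing (𝓞 ↥(maximalRealSubfield L)) ↥(maximalRealSubfield L))ˣ) : AdeleRing (𝓞 ↥(maximalRealSubfield L)) ↥(maximalRealSubfield L)).2 v :
          v.adicCompletion ↥(maximalRealSubfield L)))
        ((cmQuadraticGenerator L : ↥(maximalRealSubfield L)) : v.adicCompletion ↥(maximalRealSubfield L)) :=
  Finset.prod_congr rfl fun v _ => p.finKappaAt_toLocal_eq_hilbertSymbol hGreg hg hv₀ hv₀0 W hW v

end Kappa

end Literature.NumberTheory.Rogawski1990

end
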